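import Summits.AtomisticToContinuum.FouriersLaw.Theorems.PhononMeanFreePathCoherentDephasingLocalFGR

/-!
# Line `Sketch` of crux `PhononMeanFreePath.CoherentDephasing` (stmt-AtomisticToContinuum-11810): geometric decay of the far-bath dissipation from SITEWISE passivity and a bulk local FGR bound

Helper file (pure real analysis over `ℕ`-indexed real families) for the lead's sitewise form of the line. At one parameter
point and one chain length `N` (sites `0..N`, bonds `0..N-1`), let `J b` be the time-integrated symmetric harmonic coherent
flux through bond `b`, `s x` the site work of the mean anharmonic force, `E x ≥ 0` the time-integrated coherent site
energy, `D₀ = γ∫₀^∞ m₀²`, `D = γ∫₀^∞ m_N²` the two bath dissipations and `T2 = T²/2` the kick energy. The fixed-`N`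
bookkeeping (Dynkin + FTC) gives the site balances

  `T2 = J 0 + s 0 + D₀` (site 0),  `J (x-1) - J x = s x` (`1 ≤ x ≤ N-1`),  `J (N-1) = s N + D` (site `N`),

and AM–GM the transport bound `J b ≤ E b + E (b+1)`. The two `N`-uniform hypotheses are sitewise passivity `0 ≤ s x`
at EVERY site and the local FGR bound `κ E x ≤ s x` at the BULK sites `L ≤ x ≤ N - L`.

* `flux_nonneg_of_passive` — `0 ≤ J b` for every bond (`J (N-1) = s N + D ≥ 0` and the flux is non-increasing);
* `dissipation_le_geometric_sitewise` — `D ≤ T2 · θ^{(N - 2L)/L₀}` with the `N`-free ratio `θ = 2/(κ(L₀-1)+2)` of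
  `LocalFGR.blockLaw_of_localFGR`, for every block length `L₀ ≥ 1` and every `N ≥ 2L + 1`: passivity makes `J`
  non-increasing from `J 0 ≤ T2` to `J (N-1) ≥ D`, and each of the `k = (N-2L)/L₀` consecutive bulk blocks
  `(L + iL₀, L + (i+1)L₀]` multiplies the flux by at most `θ`.

With `tendsto_natMul_pow_div` (`Theorems/…Telescoping.lean`) this is `N · D_N → 0`, i.e. the crux, once the fixed-`N`
balances and the two sitewise hypotheses are supplied.
-/

noncomputable section

open Finset

namespace Summit.AtomisticToContinuum.FouriersLaw.Theorems.CoherentDephasing.SitewiseComposition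

open Summit.AtomisticToContinuum.FouriersLaw.Theorems.CoherentDephasing.LocalFGR

/-- [folklore] With the tail balance `J (N-1) = s N + D`, `D ≥ 0`, passivity and the bulk balances, every flux is
non-negative and at least `D`: `D ≤ J b` for `b ≤ N - 1`. -/
theorem dissipation_le_flux (J s : ℕ → ℝ) (D : ℝ) (N : ℕ) (hN : 1 ≤ N)
    (hbal : ∀ x, 1 ≤ x → x + 1 ≤ N → J (x - 1) - J x = s x) (htail : J (N - 1) = s N + D)
    (hpass : ∀ x, x ≤ N → 0 ≤ s x) (b : ℕ) (hb : b + 1 ≤ N) : D ≤ J b := by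
  have hmono := flux_antitone_of_passive J s b (N - 1) (fun x h1 h2 => hbal x (by omega) (by omega))
    (fun x _ h2 => hpass x (by omega)) b le_rfl (by omega)
  have hsN := hpass N le_rfl
  linarith

/-- [folklore] **Geometric decay of the far-bath dissipation from sitewise passivity and a bulk local FGR bound.**
See the module docstring: `D ≤ T2 · (2/(κ(L₀-1)+2))^{(N-2L)/L₀}` for `N ≥ 2L + 1`, `L, L₀ ≥ 1`. -/
theorem dissipation_le_geometric_sitewise :
    ∀ (J s E : ℕ → ℝ) (D₀ D T2 κ : ℝ) (N L L₀ : ℕ), 0 < κ → 0 < L → 0 < L₀ → 2 * L + 1 ≤ N → 0 ≤ D₀ → 0 ≤ D →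
      T2 = J 0 + s 0 + D₀ → (∀ x, 1 ≤ x → x + 1 ≤ N → J (x - 1) - J x = s x) → J (N - 1) = s N + D →
      (∀ x, x ≤ N → 0 ≤ s x) → (∀ x, L ≤ x → x + L ≤ N → κ * E x ≤ s x) → (∀ x, 0 ≤ E x) →
      (∀ b, b + 1 ≤ N → J b ≤ E b + E (b + 1)) →
      D ≤ T2 * (2 / (κ * ((L₀ - 1 : ℕ) : ℝ) + 2)) ^ ((N - 2 * L) / L₀) := by
  intro J s E D₀ D T2 κ N L L₀ hκ hL hL₀ hN hD₀ hD hhead hbal htail hpass hfgr hE htr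
  set θ : ℝ := 2 / (κ * ((L₀ - 1 : ℕ) : ℝ) + 2) with hθ
  have hθ0 : 0 ≤ θ := by rw [hθ]; positivity
  set k : ℕ := (N - 2 * L) / L₀ with hk
  -- the flux is non-increasing on `[0, N-1]` and non-negative
  have hanti : ∀ b b' : ℕ, b ≤ b' → b' + 1 ≤ N → J b' ≤ J b := fun b b' h1 h2 =>
    flux_antitone_of_passive J s b b' (fun x hx1 hx2 => hbal x (by omega) (by omega))
      (fun x _ hx2 => hpass x (by omega)) b le_rfl h1
  have hJ0 : J 0 ≤ T2 := by have := hpass 0 (by omega); linarith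
  -- one bulk block `(c, c + L₀]` with `L ≤ c`, `c + L₀ + L ≤ N`: `J (c + L₀) ≤ θ · J c`
  have hblock : ∀ c : ℕ, L ≤ c → c + L₀ + L ≤ N → J (c + L₀) ≤ θ * J c := by
    intro c hc1 hc2
    have hb := blockLaw_of_localFGR J s E κ L₀ c (c + L₀) hκ hL₀ le_rfl
      (fun x h1 h2 => hbal x (by omega) (by omega)) (fun x _ h2 => hpass x (by omega))
      (fun x h1 h2 => hfgr x (by omega) (by omega)) hE (fun b'' h1 h2 => htr b'' (by omega))
    have hJc : 0 ≤ J c := (dissipation_le_flux J s D N (by omega) hbal htail hpass c (by omega)).trans' hD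
    rw [max_eq_left hJc] at hb
    rw [hθ]
    linarith
  -- iterate over the `k` blocks starting at `L`
  have hiter : ∀ i : ℕ, i ≤ k → J (L + i * L₀) ≤ θ ^ i * J L := by
    intro i
    induction i with
    | zero => intro; simp
    | succ i ih =>
      intro hi
      have hkL : k * L₀ ≤ N - 2 * L := by rw [hk]; exact Nat.div_mul_le_self _ _
      have hroom : L + i * L₀ + L₀ + L ≤ N := by
        have : (i + 1) * L₀ ≤ k * L₀ := Nat.mul_le_mul_right _ hi
        rw [Nat.add_mul, one_mul] at this
        omega
      have h1 := hblock (L + i * L₀) (by omega) hroom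
      have h2 := ih (by omega)
      have e : L + (i + 1) * L₀ = L + i * L₀ + L₀ := by ring
      rw [e, pow_succ]
      calc J (L + i * L₀ + L₀) ≤ θ * J (L + i * L₀) := h1
        _ ≤ θ * (θ ^ i * J L) := mul_le_mul_of_nonneg_left h2 hθ0
        _ = θ ^ i * θ * J L := by ring
  -- conclude: `D ≤ J (N-1) ≤ J (L + k L₀) ≤ θ^k J L ≤ θ^k J 0 ≤ θ^k T2`
  have hkL : k * L₀ ≤ N - 2 * L := by rw [hk]; exact Nat.div_mul_le_self _ _
  have hbk : L + k * L₀ + 1 ≤ N := by omega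
  have hDle : D ≤ J (L + k * L₀) := dissipation_le_flux J s D N (by omega) hbal htail hpass _ hbk
  have hJL : J L ≤ J 0 := hanti 0 L (Nat.zero_le _) (by omega)
  have hθk : 0 ≤ θ ^ k := pow_nonneg hθ0 k
  calc D ≤ J (L + k * L₀) := hDle
    _ ≤ θ ^ k * J L := hiter k le_rfl
    _ ≤ θ ^ k * T2 := mul_le_mul_of_nonneg_left (hJL.trans hJ0) hθk
    _ = T2 * θ ^ k := by ring

end Summit.AtomisticToContinuum.FouriersLaw.Theorems.CoherentDephasing.SitewiseComposition

end
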